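import Summits.BirchSwinnertonDyer.Rank1Residual.X11b.Three.KolyvaginShaThreeRatOfProp37
import Summits.BirchSwinnertonDyer.Rank1Residual.X11b.Three.KolyvaginShaThreeOfGross1991
import HarnessLib

/-!
# `Ш(E/ℚ)[3^∞]` on the class X11b @ 3 with `ρ̄_{E,3}` onto — NO Kodaira–Néron sub-class (KN₃) —
# modulo NAMED published facts ONLY; in particular clause (ii) of `BSD(E, 3)`, `Ш(E/ℚ)[3^∞]` finite,
# for EVERY `(E, 3) ∈ ClassX11b W 3 ∩ surj(3)`, from SEVEN named facts and nothing else

Cell `b2b-bsdres`, team x11b3 (N8/O2 = X11b @ 3); seat x11b3-p2 GEN 54 (unit claimed D-0075 →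
BSD:K2/P4 «Kolyvagin-in-kernel»).  Summit-side THEOREM-ONLY file (no definition, no named fact,
no `sorry`); `K : Type`; the literal prime `3`.

HONEST FRAMING (cell `b2b-bsdres`, run/shared/lean/b2b/bsd-rank1-residual/, verbatim in every
file): the goal of the cell is to DELETE the COMBINATION-SHAPED residual classes of the
Birch–Swinnerton-Dyer formula for ALL analytic-rank `≤ 1` elliptic curves over `ℚ` — "full BSD
formula for every rank `≤ 1` curve in class `C`" assembled STRICTLY from published theorems — so
that the rank-`≤ 1` remainder becomes exactly the CONSTRUCTION-SHAPED classes, which are TYPED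
(missing-input `Prop`s), NOT attempted.  This is not "finishing BSD".  Nothing here is booked; no
mark / label / count / tier moves; X11b @ 3 = O2/B10 stays OPEN / CONSTRUCTION-SHAPED (clause
(ii) of `BSDp W 3` is `Ш[3^∞]` finite; clause (iii), the `3`-part of the formula, is NOT touched —
Kolyvagin bounds `Ш` relative to the Heegner index).

WHAT THIS FILE DOES.  The ℚ-side / class-level ENDs of record (`X11b/Three/KolyvaginShaThreeRatOfProp37`,
x11b3-p2 GEN 53; headline `finite_primaryComponent_sha_three_of_classX11b_of_kodairaNeron_of_namedFacts`:
`Ш(E/ℚ)[3^∞]` finite on ClassX11b W 3 ∩ (KN₃)/ℚ modulo SIX named facts) live on the Kodaira–Néron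
sub-class (KN₃)/ℚ (`3 ∤ ord_ℓ Δ_min` at multiplicative `ℓ`; no IV / IV* additive place), which both
SUPPLIED the receptacle input [GZ86, III (3.1)] by Kodaira–Néron and forced `ρ̄_{E,3}` onto.  With
[GZ86, III (3.1)] now the NAMED Literature fact `Gross1991_heegnerPoint_sub_ratTorsion_mem_E0`
(read into the x11b3 binder by `KolyvaginHloc.hGZ_of_gross1991E0`, this GEN) the K-side ENDs hold on
ClassX11b W 3 ∩ surj(3) with NO (KN₃) (`X11b/Three/KolyvaginShaThreeOfGross1991`, this GEN).  THIS
FILE descends them to `ℚ` along `res : Ш(E/ℚ) → Ш(E_K/K)` — injective on `3`-primary parts since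
`[K : ℚ] = 2` is prime to `3` (tree `KolyvaginAssembly.sha_primary_finite_of_baseChange_of_coprime` /
`pow_smul_sha_primary_eq_zero_of_baseChange_of_coprime`, x11b3 (P2-QUANT) FILE D) — and removes
the `(K, y_K)` datum exactly as GEN 36's FILE E / GEN 52 did (a Hoffstein–Luo odd Heegner field
`exists_oddHeegnerData`; `y_K` non-torsion by Gross–Zagier at `r_an = 1`,
`not_isOfFinAddOrder_of_heegner_of_analyticRank_eq_one`).  HEADLINE (honest):
`finite_primaryComponent_sha_three_of_classX11b_of_surj_of_namedFacts` — for EVERY `E/ℚ`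
(globally minimal model `W`) with `(E, 3) ∈ ClassX11b W 3` (`r_an = 1`, `3 ‖ N`, `ρ̄_{E,3}`
irreducible) AND `ρ̄_{E,3}` onto (`Surj W 3`) — no condition on Tamagawa numbers or Kodaira types,
i.e. all of X11b @ 3 off the non-surjective corner (T4″)₃ — `Ш(E/ℚ)[3^∞]` is FINITE, clause (ii)
of `BSDp W 3` verbatim, CONDITIONAL on SEVEN NAMED PUBLISHED FACTS of the tree and NOTHING ELSE:
`gross_zagier` (∀), `hasEntireLFunction_rat`, `exists_isNewformOf`,
`HoffsteinLuo1997_exists_twist_L_one_ne_zero`, `mazur_not_dvd_maninConstant_of_odd`,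
`GrossLMS1991.prop37_2_reductionCongruence` (∀ `K`; or its CLOSED image-free sibling
`prop37_2_frobeniusCongruence`, primed form), `Gross1991_heegnerPoint_sub_ratTorsion_mem_E0`; no
`(K, y_K)` datum, no inline hypothesis, no (KN₃).  The GEN 53 headline covered ClassX11b W 3 ∩
(KN₃)/ℚ ⊆ ClassX11b W 3 ∩ surj(3) with six facts; the seventh fact buys the rest of surj(3).  A
conditional result on cited published statements (D-0014 named facts), not an unconditional
theorem; none of the seven is discharged here; nothing booked; no mark / count / tier moves.

## What is proved (namespace `Summit.BirchSwinnertonDyer.Rank1Residual.X11b.Three.KolyvaginDischarged`)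

* `finite_primaryComponent_sha_three_of_classX11b_of_surj_of_gross1991E0_rat_of_prop37` — with
  `(K, y_K)`: `Ш(E/ℚ)[3^∞]` finite, modulo the two named facts at `3` + `hN` + `hS`.
* `pow_smul_sha_rat_three_primary_eq_zero_of_classX11b_of_surj_of_gross1991E0_rat_of_prop37` —
  `3^{m+1} ∤ y_K ⟹ 3^{m} · Ш(E/ℚ)[3^∞] = 0` (exponent `m`, sharper than the `2m` of the (KN₃)
  twin, from the annihilator END), same footing.
* `primaryComponent_sha_three_eq_bot_of_classX11b_of_surj_of_gross1991E0_rat_of_not_dvd_of_prop37` —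
  `3 ∤ y_K ⟹ Ш(E/ℚ)[3^∞] = 0`, same footing.
* `finite_primaryComponent_sha_three_of_classX11b_of_surj_of_namedFacts` — the class-level END:
  `Ш(E/ℚ)[3^∞]` finite on ClassX11b W 3 ∩ surj(3) modulo SEVEN NAMED facts, no `(K, y_K)`, no (KN₃).
* `finite_primaryComponent_sha_three_of_classX11b_of_surj_of_namedFacts'` — the same keyed to the
  CLOSED image-free sibling `GrossLMS1991.prop37_2_frobeniusCongruence`.

## References

* [GrossLMS1991] B. H. Gross, LMS LNS 153 (1991), §1 (p. 235), §2 (p. 237) Prop. 2.1, Thm. 1.3 (2),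
  §3 Prop. 3.7 (2) (p. 240), Prop. 5.3, §6 Prop. 6.2 (1) and its proof (p. 245).
* [McCallumLMS1991] W. G. McCallum, same volume, §1 Theorem (Kolyvagin), Lemma 5.1.
* [GrossZagier1986Heegner] Invent. Math. 84 (1986), I (6.3), III (3.1) (p. 256).
* [Miller2011LMS] R. L. Miller, LMS J. Comput. Math. 14 (2011), Def. 1.1 (ii).
* [HoffsteinLuo1997] Math. Res. Lett. 4 (1997), Theorem (§1).  [SerreGaloisCohomology1997] I.§2.4.
  [Nekovar2007] Prop. 4.9, 4.13 (ii).  [SilvermanATAEC1994] Thm. II.6.4.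

presearch: `lean search 'of_surj_of_namedFacts|of_surj_of_gross1991E0'` → none before this GEN;
parents = the tree ENDs named above (FILE D descent lemmas, GEN 36 FILE E field choice, this GEN's
K-side ENDs); [corpus: book:editornd-l-functions-arithmetic p0222:L1, p0217:L19–L22]; nothing minted.
-/

noncomputable section

open scoped Classical
open WeierstrassCurve Field NumberField IsDedekindDomain
open Literature.NumberTheory.EllipticCurves Literature.NumberTheory.GaloisRepresentations
open Literature.NumberTheory.EllipticCurves.Rank1Residual
open Literature.NumberTheory.EllipticCurves.RingClassField
open Literature.NumberTheory.EllipticCurves.ModularForms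
open Literature.NumberTheory.DiophantineGeometry Literature.NumberTheory.DiophantineGeometry.TateAlgorithm
open Literature.NumberTheory.EllipticCurves.GrossLMS1991 (prop37_2_reductionCongruence
  prop37_2_frobeniusCongruence prop37_2_reductionCongruence_of_frobeniusCongruence)
open Summit.BirchSwinnertonDyer.Rank1Residual.X11b.KolyvaginAssembly

namespace Summit.BirchSwinnertonDyer.Rank1Residual.X11b.Three.KolyvaginDischarged

-- `K : Type`: the tree's ring-class class field theory is universe `0`.
variable {K : Type} [Field K] [NumberField K] {N : ℕ} {W : WeierstrassCurve ℚ}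

/-! ### §1 The three ℚ-side ENDs with `(K, y_K)`, on ClassX11b W 3 ∩ surj(3), no (KN₃) -/

/-- **On the class X11b @ 3 with `ρ̄_{E,3}` onto, `Ш(E/ℚ)[3^∞]` is finite — clause (ii) of Miller's
`BSD(E, 3)` (`BSDp W 3`) VERBATIM — NO Kodaira–Néron hypothesis — modulo the TWO NAMED facts
`GrossLMS1991.prop37_2_reductionCongruence N W K 3` and `Gross1991_heegnerPoint_sub_ratTorsion_mem_E0`.**
The K-side END `sha_primary_finite_three_of_classX11b_of_surj_of_gross1991E0_of_prop37`
(`Ш(E/K)[3^∞]` finite) descended along `res : Ш(E/ℚ) → Ш(E_K/K)`, injective on `3`-primary parts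
because `[K : ℚ] = 2` (`hK.1`) is prime to `3` (`sha_primary_finite_of_baseChange_of_coprime`).  For
`(E, 3) ∈ ClassX11b W 3` with `Surj W 3`, at `N = N_E`, ANY `K : Type` imaginary quadratic with the
Heegner hypothesis carrying a non-torsion Heegner point `P`: `Finite (AddCommGroup.primaryComponent W.sha 3)`.
CONDITIONAL on EXACTLY the two named facts (PUBLISHED, NOT discharged) + `hN` + `hS`; `(K, P)` NOT
supplied; nothing booked; no mark / count / tier moves.
[cite: Miller2011LMS, Def. 1.1 (ii)] [cite: McCallumLMS1991, §1 Theorem (Kolyvagin)]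
[cite: GrossLMS1991, §3 Prop. 3.7 (2) (p. 240), §6 Prop. 6.2 (1) (p. 245)] [cite: SerreGaloisCohomology1997, I.§2.4] -/
theorem finite_primaryComponent_sha_three_of_classX11b_of_surj_of_gross1991E0_rat_of_prop37 [NeZero N]
    [W.IsGloballyMinimal] (hW : ClassX11b W 3) (hS : Surj W 3)
    (hN : ∀ [W.IsElliptic], N = W.conductorNorm ℤ)
    (hE0 : Gross1991_heegnerPoint_sub_ratTorsion_mem_E0) (hγ : prop37_2_reductionCongruence N W K 3) :
    ∀ [W.IsElliptic] (_hK : IsImaginaryQuadratic K) (_hH : SatisfiesHeegnerHypothesis N K)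
      {P : (W.baseChange K).toAffine.Point} (_hP : IsHeegnerPoint N W K P)
      (_hnt : ¬ IsOfFinAddOrder P), Finite (AddCommGroup.primaryComponent W.sha 3) := by
  intro _ hK hH P hP hnt
  haveI : Algebra.IsQuadraticExtension ℚ K := ⟨hK.1⟩
  have h3 : (3 : ℕ).Coprime (Module.finrank ℚ K) := by rw [hK.1]; decide
  exact (sha_primary_finite_of_baseChange_of_coprime W K h3
    (sha_primary_finite_three_of_classX11b_of_surj_of_gross1991E0_of_prop37 hW hS hN hE0 hγ hK hH hP
      hnt)).to_subtype

/-- **On the class X11b @ 3 with `ρ̄_{E,3}` onto: `3^{m} · Ш(E/ℚ)[3^∞] = 0` for every `m` with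
`3^{m+1} ∤ y_K` in `E(K)` — NO Kodaira–Néron hypothesis — modulo the TWO NAMED facts.**  The K-side
annihilator `pow_smul_sha_three_primary_eq_zero_of_classX11b_of_surj_of_gross1991E0_of_prop37`
descended along `res` (`pow_smul_sha_primary_eq_zero_of_baseChange_of_coprime`, `[K : ℚ] = 2` prime
to `3`).  Exponent `m` (McCallum §5 with Lemma 5.1), sharper than the `2m` of the (KN₃)/ℚ twin
`pow_smul_sha_rat_three_primary_eq_zero_of_classX11b_of_kodairaNeron_rat_of_prop37`; otherwise the
same binders with `hKN3m` / `hKN3a` REPLACED by `hS` + `hE0`.  CONDITIONAL on EXACTLY the two named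
facts + `hN` + `hS`; nothing booked; no mark.
[cite: McCallumLMS1991, §1 Theorem (Kolyvagin), Lemma 5.1] [cite: GrossLMS1991, §3 Prop. 3.7 (2), §6 Prop. 6.2 (1)]
[cite: SerreGaloisCohomology1997, I.§2.4] -/
theorem pow_smul_sha_rat_three_primary_eq_zero_of_classX11b_of_surj_of_gross1991E0_rat_of_prop37 [NeZero N]
    [W.IsGloballyMinimal] (hW : ClassX11b W 3) (hS : Surj W 3)
    (hN : ∀ [W.IsElliptic], N = W.conductorNorm ℤ)
    (hE0 : Gross1991_heegnerPoint_sub_ratTorsion_mem_E0) (hγ : prop37_2_reductionCongruence N W K 3) :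
    ∀ [W.IsElliptic] (_hK : IsImaginaryQuadratic K) (_hH : SatisfiesHeegnerHypothesis N K)
      {P : (W.baseChange K).toAffine.Point} (_hP : IsHeegnerPoint N W K P)
      (_hnt : ¬ IsOfFinAddOrder P) {m : ℕ}
      (_hm : ∀ Q : (W.baseChange K).toAffine.Point, 3 ^ (m + 1) • Q ≠ P) (c : W.sha),
      (∃ j : ℕ, 3 ^ j • c = 0) → 3 ^ m • c = 0 := by
  intro _ hK hH P hP hnt m hm
  haveI : Algebra.IsQuadraticExtension ℚ K := ⟨hK.1⟩
  have h3 : (3 : ℕ).Coprime (Module.finrank ℚ K) := by rw [hK.1]; decide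
  exact pow_smul_sha_primary_eq_zero_of_baseChange_of_coprime W K h3
    (pow_smul_sha_three_primary_eq_zero_of_classX11b_of_surj_of_gross1991E0_of_prop37 hW hS hN hE0 hγ
      hK hH hP hnt hm)

/-- **On the class X11b @ 3 with `ρ̄_{E,3}` onto: `3 ∤ y_K` in `E(K)` ⟹ `Ш(E/ℚ)[3^∞] = 0`** (as
Mathlib's `AddCommGroup.primaryComponent W.sha 3 = ⊥`) — NO Kodaira–Néron hypothesis — the case
`m = 0` of the ℚ-side annihilator (Gross 1991 Prop. 2.1 (2) at `p = 3`, descended to `ℚ`); modulo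
the TWO NAMED facts + `hN` + `hS`; nothing booked; no mark.
[cite: GrossLMS1991, §2 Prop. 2.1 (2), §3 Prop. 3.7 (2), §6 Prop. 6.2 (1)] [cite: McCallumLMS1991, §1 Theorem (Kolyvagin)]
[cite: SerreGaloisCohomology1997, I.§2.4] -/
theorem primaryComponent_sha_three_eq_bot_of_classX11b_of_surj_of_gross1991E0_rat_of_not_dvd_of_prop37 [NeZero N]
    [W.IsGloballyMinimal] (hW : ClassX11b W 3) (hS : Surj W 3)
    (hN : ∀ [W.IsElliptic], N = W.conductorNorm ℤ)
    (hE0 : Gross1991_heegnerPoint_sub_ratTorsion_mem_E0) (hγ : prop37_2_reductionCongruence N W K 3) :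
    ∀ [W.IsElliptic] (_hK : IsImaginaryQuadratic K) (_hH : SatisfiesHeegnerHypothesis N K)
      {P : (W.baseChange K).toAffine.Point} (_hP : IsHeegnerPoint N W K P)
      (_hnt : ¬ IsOfFinAddOrder P) (_h3 : ∀ Q : (W.baseChange K).toAffine.Point, 3 • Q ≠ P),
      AddCommGroup.primaryComponent W.sha 3 = ⊥ := by
  intro _ hK hH P hP hnt h3
  refine eq_bot_iff.mpr fun c hc ↦ ?_
  have h := pow_smul_sha_rat_three_primary_eq_zero_of_classX11b_of_surj_of_gross1991E0_rat_of_prop37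
    hW hS hN hE0 hγ hK hH hP hnt (m := 0) (fun Q ↦ by simpa using h3 Q) c
    ((AddCommGroup.mem_primaryComponent).mp hc)
  simpa using h

/-! ### §2 The class-level END: no `(K, y_K)`, no (KN₃), SEVEN named facts -/

/-- **On the class X11b @ 3 with `ρ̄_{E,3}` onto, `Ш(E/ℚ)[3^∞]` is finite — clause (ii) of `BSD(E, 3)`
(`BSDp W 3`) VERBATIM — from SEVEN NAMED PUBLISHED FACTS and nothing else: NO `(K, y_K)` hypothesis,
NO inline cite-only input, NO Kodaira–Néron sub-class.**  Data as in GEN 36's FILE E / GEN 52: a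
Hoffstein–Luo odd Heegner field `K` (`exists_oddHeegnerData`; `hnf`, `hHL`, `hMaz`), its Heegner
point non-torsion by Gross–Zagier (`not_isOfFinAddOrder_of_heegner_of_analyticRank_eq_one`; `hGZ`,
`hmod`, `r_an = 1`); then §1's `finite_primaryComponent_sha_three_of_classX11b_of_surj_of_gross1991E0_rat_of_prop37`
at that `K` (`N = N_E`).  For EVERY `E/ℚ` (globally minimal `W`) with `(E, 3) ∈ ClassX11b W 3`
(`r_an = 1`, `3 ‖ N`, `ρ̄_{E,3}` irreducible) and `Surj W 3` (`ρ̄_{E,3}` onto):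
`Finite (AddCommGroup.primaryComponent W.sha 3)`.  CONDITIONAL on EXACTLY the named facts
{`gross_zagier` (∀ `N W K`), `hasEntireLFunction_rat`, `exists_isNewformOf`,
`HoffsteinLuo1997_exists_twist_L_one_ne_zero`, `mazur_not_dvd_maninConstant_of_odd`,
`GrossLMS1991.prop37_2_reductionCongruence` (∀ `K`), `Gross1991_heegnerPoint_sub_ratTorsion_mem_E0`}
— all PUBLISHED, citation-tagged `def … : Prop`s of `Literature/`, none discharged here — + `hS`.
Compared with GEN 53's `finite_primaryComponent_sha_three_of_classX11b_of_kodairaNeron_of_namedFacts`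
(six facts + (KN₃)/ℚ): one fact more, the Kodaira–Néron hypotheses `hKN3m` / `hKN3a` GONE, `hS`
explicit ((KN₃)/ℚ implied it).  A conditional result (D-0014 named facts), not an unconditional
theorem; clause (iii) of `BSDp W 3` untouched; nothing booked; no mark / count / tier moves.
[cite: Miller2011LMS, Def. 1.1 (ii)] [cite: HoffsteinLuo1997, Theorem (§1)]
[cite: GrossZagier1986Heegner, I (6.3) and III (3.1)] [cite: McCallumLMS1991, §1 Theorem (Kolyvagin)]
[cite: GrossLMS1991, §3 Prop. 3.7 (2) (p. 240), §6 Prop. 6.2 (1) (p. 245), §1 (p. 235), §2 (p. 237)] -/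
theorem finite_primaryComponent_sha_three_of_classX11b_of_surj_of_namedFacts [W.IsElliptic]
    [W.IsGloballyMinimal] [NeZero (W.conductorNorm ℤ)] (hX : ClassX11b W 3) (hS : Surj W 3)
    -- published inputs (named facts of the tree)
    (hGZ : ∀ (N : ℕ) [NeZero N] (W : WeierstrassCurve ℚ) (K : Type) [Field K] [NumberField K],
      gross_zagier N W K)
    (hmod : hasEntireLFunction_rat) (hnf : exists_isNewformOf)
    (hHL : HoffsteinLuo1997_exists_twist_L_one_ne_zero) (hMaz : mazur_not_dvd_maninConstant_of_odd)
    (hE0 : Gross1991_heegnerPoint_sub_ratTorsion_mem_E0)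
    -- Gross 1991 Prop. 3.7 (2) AT 3, BY NAME, for every number field `K`
    (hγ : ∀ (K : Type) [Field K] [NumberField K],
      prop37_2_reductionCongruence (W.conductorNorm ℤ) W K 3) :
    Finite (AddCommGroup.primaryComponent W.sha 3) := by
  obtain ⟨hr, -, hmult, hirr⟩ := id hX
  obtain ⟨K, _, _, Dt, H, ι, P, Wd, _, _, Cd, hK, hodd, hpd, hHN, hP, hc, hμ, hLt, hWd⟩ :=
    exists_oddHeegnerData hnf hHL hMaz integral_neronScaling_of_isGloballyMinimal_holds W 3 hr
      (by decide) hmult hirr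
  have hPinf : ¬ IsOfFinAddOrder P :=
    not_isOfFinAddOrder_of_heegner_of_analyticRank_eq_one W _ K Dt H ι P (hGZ _ W K) hmod hr hK hHN
      hLt hP
  exact finite_primaryComponent_sha_three_of_classX11b_of_surj_of_gross1991E0_rat_of_prop37
    (N := W.conductorNorm ℤ) hX hS (@fun _ ↦ rfl) hE0 (hγ K) hK hHN ⟨Dt, H, ι, hP⟩ hPinf

/-- **The same class-level END keyed to the CLOSED image-free print of the congruence** —
`GrossLMS1991.prop37_2_frobeniusCongruence` (Gross 1991 Prop. 3.7 (2) = Nekovář 2007 Prop. 4.9 /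
4.13 (ii) for `X_0(N)`), which implies `prop37_2_reductionCongruence N W K p` at every `(N, W, K, p)`
by the tree theorem `prop37_2_reductionCongruence_of_frobeniusCongruence`.  For EVERY `E/ℚ` (globally
minimal `W`) with `(E, 3) ∈ ClassX11b W 3` and `Surj W 3`: `Finite (AddCommGroup.primaryComponent W.sha 3)`
— clause (ii) of `BSDp W 3` — CONDITIONAL on EXACTLY SEVEN CLOSED NAMED PUBLISHED FACTS of
`Literature/` {`gross_zagier` (∀), `hasEntireLFunction_rat`, `exists_isNewformOf`,
`HoffsteinLuo1997_exists_twist_L_one_ne_zero`, `mazur_not_dvd_maninConstant_of_odd`,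
`prop37_2_frobeniusCongruence`, `Gross1991_heegnerPoint_sub_ratTorsion_mem_E0`} and nothing else (no
`(K, y_K)`, no inline hypothesis, no (KN₃)); none discharged here; a conditional result (D-0014),
not an unconditional theorem; clause (iii) untouched; nothing booked; no mark / count / tier moves.
[cite: Miller2011LMS, Def. 1.1 (ii)] [cite: Nekovar2007, Prop. 4.9 and Prop. 4.13 (ii)]
[cite: GrossLMS1991, §3 Prop. 3.7 (2) (p. 240), §6 Prop. 6.2 (1) (p. 245)] [cite: HoffsteinLuo1997, Theorem (§1)]
[cite: GrossZagier1986Heegner, I (6.3) and III (3.1)] [cite: McCallumLMS1991, §1 Theorem (Kolyvagin)] -/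
theorem finite_primaryComponent_sha_three_of_classX11b_of_surj_of_namedFacts' [W.IsElliptic]
    [W.IsGloballyMinimal] [NeZero (W.conductorNorm ℤ)] (hX : ClassX11b W 3) (hS : Surj W 3)
    -- published inputs (named facts of the tree)
    (hGZ : ∀ (N : ℕ) [NeZero N] (W : WeierstrassCurve ℚ) (K : Type) [Field K] [NumberField K],
      gross_zagier N W K)
    (hmod : hasEntireLFunction_rat) (hnf : exists_isNewformOf)
    (hHL : HoffsteinLuo1997_exists_twist_L_one_ne_zero) (hMaz : mazur_not_dvd_maninConstant_of_odd)
    (hE0 : Gross1991_heegnerPoint_sub_ratTorsion_mem_E0) (hγ : prop37_2_frobeniusCongruence) :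
    Finite (AddCommGroup.primaryComponent W.sha 3) :=
  finite_primaryComponent_sha_three_of_classX11b_of_surj_of_namedFacts hX hS hGZ hmod hnf hHL hMaz hE0
    (fun K _ _ ↦ prop37_2_reductionCongruence_of_frobeniusCongruence hγ (W.conductorNorm ℤ) W K 3)

end Summit.BirchSwinnertonDyer.Rank1Residual.X11b.Three.KolyvaginDischarged

end
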